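import Literature.Analysis.FluidPDE.ElgindiAngularHardy
import HarnessLib

/-!
# The Dirichlet Wirtinger–Poincaré inequality on an interval ([Elgindi2021] §7.1, the spectral
gap behind "`|∂_θΨ|² − 6|Ψ|²`" and the sine series `Ψ = ΣΨ_n(R)sin(2nθ)`)

Topic `Literature/Analysis/FluidPDE`. Proof file (everything proved, no definitions, no named
facts) on the proof path of the named fact
`Literature.Analysis.FluidPDE.Elgindi.ElgindiGhoulMasmoudi2021_stabilityCore`
(`ElgindiStabilityDecomposition.lean`). T. M. Elgindi, Ann. of Math. 194 (2021) =
arXiv:1904.04795, §7.1 proof of Proposition 7.1 (p. 19 of the held text):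

> "In particular, since `0 < α ≤ 1` we have: `|∂_θΨ|² − 6|Ψ|² ≤ |F|_{L²}|Ψ|_{L²}`. Now let's expand the
> left hand side in a series (recalling the boundary conditions): `Ψ(R,θ) = Σ_{n∈ℕ}Ψ_n(R)sin(2nθ)`. In
> particular, `Σ_{n≥2}(4n² − 6)|Ψ_n(R)|² ≤ 2|Ψ_1(R)|² + |F||Ψ|`."

The first ingredient of this mode analysis is the Dirichlet spectral gap of `−∂_θθ` on `[0, π/2]`:
`∫₀^{π/2}(∂_θΨ)² ≥ 4∫₀^{π/2}Ψ²` for `Ψ(0) = Ψ(π/2) = 0` (the first eigenvalue `4 = (2·1)²`, eigenfunction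
`sin(2θ)`). This file proves the general interval version `∫₀ᴸu'² ≥ (π/L)²∫₀ᴸu²` for `u ∈ C¹(ℝ)` with
`u(0) = u(L) = 0` (`wirtinger_dirichlet`) by the ground-state identity
`u'² − (π/L)²u² = (u' − u·s'/s)² + (u²s'/s)'`, `s = sin(πx/L)`, integrated on `[ε, L − ε]` with the
boundary terms `O(ε)` (no limits: `le_of_forall_pos_le_add`), and the quarter case (`wirtinger_quarter`).
-/

noncomputable section

open MeasureTheory Set Real Filter intervalIntegral
open _root_.Topology

namespace Literature.Analysis.FluidPDE

namespace Elgindi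

/-- **The Dirichlet Wirtinger–Poincaré inequality**: for `u ∈ C¹(ℝ)` with `u(0) = u(L) = 0`, `L > 0`,
`(π/L)²∫₀ᴸu² ≤ ∫₀ᴸu'²`. [cite: Elgindi2021, §7.1 proof of Proposition 7.1 (the sine series Ψ = ΣΨ_n sin(2nθ) and "(4n²−6)|Ψ_n|²") (p. 19 of arXiv:1904.04795)] -/
theorem wirtinger_dirichlet {u : ℝ → ℝ} (hu : ContDiff ℝ 1 u) {L : ℝ} (hL : 0 < L) (h0 : u 0 = 0) (h1 : u L = 0) :
    (π / L) ^ 2 * ∫ x in (0 : ℝ)..L, u x ^ 2 ≤ ∫ x in (0 : ℝ)..L, deriv u x ^ 2 := by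
  have hd : Differentiable ℝ u := hu.differentiable (by simp)
  have huc : Continuous u := hu.continuous
  have hdc : Continuous (deriv u) := hu.continuous_deriv le_rfl
  set k : ℝ := π / L with hk
  have hkpos : 0 < k := by positivity
  -- bounds: `|u x| ≤ M x` near `0`, `|u x| ≤ M' (L - x)` near `L`, `|u| ≤ K` on `[0, L]`
  obtain ⟨M, hM0, hM⟩ := exists_abs_le_mul_of_deriv hu h0 L
  set v : ℝ → ℝ := fun y => u (L - y) with hv
  have hvc : ContDiff ℝ 1 v := hu.comp (contDiff_const.sub contDiff_id)
  have hv0 : v 0 = 0 := by simp [hv, h1]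
  obtain ⟨M', hM'0, hM'⟩ := exists_abs_le_mul_of_deriv hvc hv0 L
  obtain ⟨K, hK⟩ := isCompact_Icc.exists_bound_of_continuousOn (s := Icc 0 L) huc.continuousOn
  have hK0 : 0 ≤ K := (norm_nonneg _).trans (hK 0 ⟨le_rfl, hL.le⟩)
  -- the comparison function `c = s'/s = k cos(kx)/sin(kx)` and `g = u² c`
  set c : ℝ → ℝ := fun x => k * Real.cos (k * x) / Real.sin (k * x) with hc
  set g : ℝ → ℝ := fun x => u x ^ 2 * c x with hg
  have hsin : ∀ x ∈ Ioo 0 L, 0 < Real.sin (k * x) := by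
    intro x hx
    refine Real.sin_pos_of_pos_of_lt_pi (mul_pos hkpos hx.1) ?_
    calc k * x < k * L := mul_lt_mul_of_pos_left hx.2 hkpos
      _ = π := by rw [hk]; field_simp
  -- derivative of `c` and of `g` inside `(0, L)`
  have hcd : ∀ x ∈ Ioo 0 L, HasDerivAt c (-k ^ 2 - c x ^ 2) x := by
    intro x hx
    have hs := hsin x hx
    have hlin : HasDerivAt (fun y : ℝ => k * y) k x := by
      simpa using (hasDerivAt_id' x).const_mul k
    have h1 : HasDerivAt (fun y => k * Real.cos (k * y)) (k * (-Real.sin (k * x) * k)) x := hlin.cos.const_mul k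
    have h2 : HasDerivAt (fun y => Real.sin (k * y)) (Real.cos (k * x) * k) x := hlin.sin
    have h := h1.div h2 hs.ne'
    refine h.congr_deriv ?_
    have hs0 : Real.sin (k * x) ≠ 0 := hs.ne'
    simp only [hc]
    field_simp
  have hgd : ∀ x ∈ Ioo 0 L, HasDerivAt g (2 * u x * deriv u x * c x + u x ^ 2 * (-k ^ 2 - c x ^ 2)) x := by
    intro x hx
    have e2 : (fun y => u y ^ 2) = fun y => u y * u y := by funext y; ring
    have h1 : HasDerivAt (fun y => u y ^ 2) (2 * u x * deriv u x) x := by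
      rw [e2]
      exact ((hd x).hasDerivAt.mul (hd x).hasDerivAt).congr_deriv (by ring)
    exact h1.mul (hcd x hx)
  -- pointwise ground-state identity: `u'² − k²u² ≥ g'`
  have hpt : ∀ x ∈ Ioo 0 L, 2 * u x * deriv u x * c x + u x ^ 2 * (-k ^ 2 - c x ^ 2) ≤ deriv u x ^ 2 - k ^ 2 * u x ^ 2 := by
    intro x _
    nlinarith [sq_nonneg (deriv u x - u x * c x)]
  -- the estimate on `[ε, L - ε]`
  have hmid : ∀ ε, 0 < ε → 2 * ε < L →
      g (L - ε) - g ε ≤ ∫ x in ε..(L - ε), (deriv u x ^ 2 - k ^ 2 * u x ^ 2) := by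
    intro ε hε hεL
    have hsub : Set.uIcc ε (L - ε) ⊆ Ioo 0 L := by
      rw [Set.uIcc_of_le (by linarith)]; intro x hx; exact ⟨by linarith [hx.1], by linarith [hx.2]⟩
    have hder : ∀ x ∈ Set.uIcc ε (L - ε), HasDerivAt g (2 * u x * deriv u x * c x + u x ^ 2 * (-k ^ 2 - c x ^ 2)) x :=
      fun x hx => hgd x (hsub hx)
    have hcc : ContinuousOn c (Set.uIcc ε (L - ε)) := by
      simp only [hc]
      refine ContinuousOn.div (by fun_prop) (by fun_prop) fun x hx => (hsin x (hsub hx)).ne'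
    have hcont' : ContinuousOn (fun x => 2 * u x * deriv u x * c x + u x ^ 2 * (-k ^ 2 - c x ^ 2)) (Set.uIcc ε (L - ε)) := by
      have h1 : ContinuousOn (fun x => 2 * u x * deriv u x) (Set.uIcc ε (L - ε)) := by fun_prop
      have h2 : ContinuousOn (fun x => u x ^ 2) (Set.uIcc ε (L - ε)) := by fun_prop
      exact (h1.mul hcc).add (h2.mul (continuousOn_const.sub (hcc.pow 2)))
    have hFTC := integral_eq_sub_of_hasDerivAt hder hcont'.intervalIntegrable
    have i2 : IntervalIntegrable (fun x => deriv u x ^ 2 - k ^ 2 * u x ^ 2) volume ε (L - ε) :=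
      ((hdc.pow 2).sub ((huc.pow 2).const_mul _)).intervalIntegrable _ _
    have hmono := intervalIntegral.integral_mono_on (by linarith) hcont'.intervalIntegrable i2 fun x hx =>
      hpt x ⟨by linarith [hx.1], by linarith [hx.2]⟩
    rw [hFTC] at hmono
    exact hmono
  -- the boundary terms are `O(ε)`: `|g ε| ≤ (π/2) M² ε`, `|g (L-ε)| ≤ (π/2) M'² ε` for `2ε ≤ L`
  have hcot : ∀ ε, 0 < ε → 2 * ε ≤ L → |c ε| ≤ π / (2 * ε) := by
    intro ε hε hεL
    have hkε : k * ε ≤ π / 2 := by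
      rw [hk]
      rw [div_mul_eq_mul_div, div_le_iff₀ hL]
      nlinarith [Real.pi_pos]
    have hs : 0 < Real.sin (k * ε) := Real.sin_pos_of_pos_of_lt_pi (by positivity) (by linarith [Real.pi_pos])
    have hj : 2 / π * (k * ε) ≤ Real.sin (k * ε) := Real.mul_le_sin (by positivity) hkε
    simp only [hc]
    rw [abs_div, abs_of_pos hs, abs_mul, abs_of_pos hkpos, div_le_div_iff₀ hs (by positivity)]
    have hcos : |Real.cos (k * ε)| ≤ 1 := Real.abs_cos_le_one _
    calc k * |Real.cos (k * ε)| * (2 * ε) ≤ k * 1 * (2 * ε) := by gcongr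
      _ = π * (2 / π * (k * ε)) := by field_simp
      _ ≤ π * Real.sin (k * ε) := mul_le_mul_of_nonneg_left hj Real.pi_pos.le
  have hgε : ∀ ε, 0 < ε → 2 * ε ≤ L → |g ε| ≤ π / 2 * M ^ 2 * ε := by
    intro ε hε hεL
    have h1 := hM ε (by rw [abs_of_pos hε]; linarith)
    rw [abs_of_pos hε] at h1
    have h2 := hcot ε hε hεL
    simp only [hg]
    rw [abs_mul]
    have hu2 : |u ε ^ 2| ≤ (M * ε) ^ 2 := by
      rw [abs_pow]; exact pow_le_pow_left₀ (abs_nonneg _) h1 2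
    calc |u ε ^ 2| * |c ε| ≤ (M * ε) ^ 2 * (π / (2 * ε)) := mul_le_mul hu2 h2 (abs_nonneg _) (by positivity)
      _ = π / 2 * M ^ 2 * ε := by field_simp
  have hgLε : ∀ ε, 0 < ε → 2 * ε ≤ L → |g (L - ε)| ≤ π / 2 * M' ^ 2 * ε := by
    intro ε hε hεL
    have h1 := hM' ε (by rw [abs_of_pos hε]; linarith)
    simp only [hv, abs_of_pos hε] at h1
    -- `|c (L - ε)| = |c ε|` by the symmetry `sin(k(L-ε)) = sin(kε)`, `cos(k(L-ε)) = -cos(kε)`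
    have hkL : k * L = π := by rw [hk]; field_simp
    have hcs : |c (L - ε)| = |c ε| := by
      simp only [hc]
      have e1 : k * (L - ε) = π - k * ε := by rw [mul_sub, hkL]
      rw [e1, Real.sin_pi_sub, Real.cos_pi_sub]
      rw [abs_div, abs_div, abs_mul, abs_mul, abs_neg]
    have h2 := hcot ε hε hεL
    rw [← hcs] at h2
    simp only [hg]
    rw [abs_mul]
    have hu2 : |u (L - ε) ^ 2| ≤ (M' * ε) ^ 2 := by
      rw [abs_pow]; exact pow_le_pow_left₀ (abs_nonneg _) h1 2
    calc |u (L - ε) ^ 2| * |c (L - ε)| ≤ (M' * ε) ^ 2 * (π / (2 * ε)) := mul_le_mul hu2 h2 (abs_nonneg _) (by positivity)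
      _ = π / 2 * M' ^ 2 * ε := by field_simp
  -- the ends: `∫ over [0,ε] and [L-ε,L] of (u'² − k²u²) ≥ −k²K²ε` each
  have iF : ∀ a b : ℝ, IntervalIntegrable (fun x => deriv u x ^ 2 - k ^ 2 * u x ^ 2) volume a b := fun a b =>
    ((hdc.pow 2).sub ((huc.pow 2).const_mul _)).intervalIntegrable _ _
  have hend : ∀ a b, 0 ≤ a → a ≤ b → b ≤ L → -(k ^ 2 * K ^ 2) * (b - a) ≤ ∫ x in a..b, (deriv u x ^ 2 - k ^ 2 * u x ^ 2) := by
    intro a b ha hab hbL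
    have hK' : ∀ x ∈ Icc a b, -(k ^ 2 * K ^ 2) ≤ deriv u x ^ 2 - k ^ 2 * u x ^ 2 := by
      intro x hx
      have h := hK x ⟨ha.trans hx.1, hx.2.trans hbL⟩
      rw [Real.norm_eq_abs] at h
      have hu2 : u x ^ 2 ≤ K ^ 2 := by rw [← sq_abs]; exact pow_le_pow_left₀ (abs_nonneg _) h 2
      nlinarith [sq_nonneg (deriv u x)]
    have := intervalIntegral.integral_mono_on hab intervalIntegrable_const (iF a b) hK'
    rw [intervalIntegral.integral_const, smul_eq_mul] at this
    linarith
  -- assemble: for every `δ > 0`, `k²∫u² ≤ ∫u'² + δ`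
  have hsplit : ∀ ε, 0 < ε → 2 * ε < L → ∫ x in (0 : ℝ)..L, (deriv u x ^ 2 - k ^ 2 * u x ^ 2) =
      (∫ x in (0 : ℝ)..ε, (deriv u x ^ 2 - k ^ 2 * u x ^ 2)) +
        ((∫ x in ε..(L - ε), (deriv u x ^ 2 - k ^ 2 * u x ^ 2)) + ∫ x in (L - ε)..L, (deriv u x ^ 2 - k ^ 2 * u x ^ 2)) := by
    intro ε _ _
    rw [integral_add_adjacent_intervals (iF _ _) (iF _ _), integral_add_adjacent_intervals (iF _ _) (iF _ _)]
  have hgoal : 0 ≤ ∫ x in (0 : ℝ)..L, (deriv u x ^ 2 - k ^ 2 * u x ^ 2) := by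
    refine le_of_forall_pos_le_add fun δ hδ => ?_
    -- choose `ε`
    set C : ℝ := 2 * (k ^ 2 * K ^ 2) + π / 2 * M ^ 2 + π / 2 * M' ^ 2 + 1 with hC
    have hCpos : 0 < C := by positivity
    obtain ⟨ε, hε, hεL, hεδ⟩ : ∃ ε, 0 < ε ∧ 2 * ε < L ∧ C * ε ≤ δ := by
      refine ⟨min (L / 4) (δ / C), lt_min (by positivity) (by positivity), ?_, ?_⟩
      · have := min_le_left (L / 4) (δ / C); linarith
      · have h1 := min_le_right (L / 4) (δ / C)
        have := mul_le_mul_of_nonneg_left h1 hCpos.le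
        have e : C * (δ / C) = δ := by field_simp
        rw [e] at this
        exact this
    have e1 := hend 0 ε le_rfl hε.le (by linarith)
    have e3 := hend (L - ε) L (by linarith) (by linarith) le_rfl
    have m := hmid ε hε hεL
    have b1 := abs_le.1 (hgε ε hε hεL.le)
    have b2 := abs_le.1 (hgLε ε hε hεL.le)
    rw [hsplit ε hε hεL]
    have : C * ε = 2 * (k ^ 2 * K ^ 2) * ε + π / 2 * M ^ 2 * ε + π / 2 * M' ^ 2 * ε + ε := by rw [hC]; ring
    nlinarith [e1, e3, m, b1.1, b1.2, b2.1, b2.2, hεδ, this, hε]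
  have iA : IntervalIntegrable (fun x => deriv u x ^ 2) volume 0 L := (hdc.pow 2).intervalIntegrable _ _
  have iB : IntervalIntegrable (fun x => k ^ 2 * u x ^ 2) volume 0 L := ((huc.pow 2).const_mul _).intervalIntegrable _ _
  rw [intervalIntegral.integral_sub iA iB, intervalIntegral.integral_const_mul] at hgoal
  linarith

/-- **The quarter case** (`L = π/2`): `4∫₀^{π/2}u² ≤ ∫₀^{π/2}u'²` for `u ∈ C¹(ℝ)` with `u(0) = u(π/2) = 0` —
the Dirichlet spectral gap of `−∂_θθ` on `[0, π/2]` with first eigenfunction `sin(2θ)`. [cite: Elgindi2021, §7.1 proof of Proposition 7.1 (p. 19 of arXiv:1904.04795)] -/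
theorem wirtinger_quarter {u : ℝ → ℝ} (hu : ContDiff ℝ 1 u) (h0 : u 0 = 0) (h1 : u (π / 2) = 0) :
    4 * ∫ x in (0 : ℝ)..(π / 2), u x ^ 2 ≤ ∫ x in (0 : ℝ)..(π / 2), deriv u x ^ 2 := by
  have h := wirtinger_dirichlet hu (L := π / 2) (by positivity) h0 h1
  have e : (π / (π / 2)) ^ 2 = 4 := by field_simp; ring
  rw [e] at h
  exact h

end Elgindi

end Literature.Analysis.FluidPDE
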